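import Literature.Algebra.Homology.ContCohomologyTransgressionKernel
import Literature.AnabelianGeometry.AbsoluteAnabelian.AbsTopIII.CcnTransgression
import HarnessLib

/-!
# [AbsTopIII] Prop. 1.4 (ii): the differential is INJECTIVE when `I_x` lies in the closed commutator subgroup of `Δ_{U_x}`

Mochizuki, *Topics in Absolute Anabelian Geometry III*, §1, Prop. 1.4 (ii), manuscript pp. 31–32 (lit
key `paper:url-5493eb38cbb7`): "applying the differential of the “`E_2`-term” of the Leray spectral
sequence associated to this group extension [...] yields an element `∈ H^2(Δ_X, H^0(I_x, I_x)) =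
Hom(M_X, I_x)` [...]; this last element corresponds to the natural isomorphism `M_X ⥲ I_x`".
abc-iut-L4-t1's NAMED FACT `CurveModel.Prop_1_4_ii_transgression M` (FACT-LIST F-0338) is the
map-level reading: for every cyclotome presentation `(U_x ⊆ X, x)` of the model and every continuous
section `s`, the differential `d_s : Hom_cont(Ker(Δ^{c-cn}_{U_x} ↠ Δ_X), Λ) → H²(Δ_X, Λ)`
(`ccnTransgression`) is BIJECTIVE.  Its universal closure over the interface is refuted
(`CcnTransgressionSplitVanishing.lean`); here is the POSITIVE HALF that the tree can prove at the
printed instance class.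

With the generic kernel computation of `ContCohomologyTransgressionKernel.lean` (exactness of the
five-term sequence at `Hom(A, Λ)`: `d_s χ = 0` iff `χ` extends to a continuous homomorphism
`Δ^{c-cn}_{U_x} → Λ` [cite: SerreGaloisCohomology1997, I §2.6 (b)]), this proof-only file (no
definitions) records:

* `ccnTransgression_injective_iff` — `d_s` is injective iff every continuous homomorphism
  `Δ^{c-cn}_{U_x} → Λ` kills `Ker(Δ^{c-cn}_{U_x} ↠ Δ_X)`;
* `ccnTransgression_injective_of_cuspidalKernel_le` — `d_s` is injective (for `T₁` coefficients
  `Λ`, e.g. `Λ = Ẑ`) as soon as `N = Ker(Π_{U_x} ↠ Π_X) ∩ Δ_{U_x}` lies in the closure of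
  `[Δ_{U_x}, Δ_{U_x}]`;
* `CurveModel.ccnTransgression_injective_of_inertia_le_commutator` — hence, relative to a model,
  **for every cyclotome presentation with `I_x ≤ [Δ_{U_x}, Δ_{U_x}]⁻` the differential of Prop. 1.4
  (ii) is INJECTIVE for every section and every `T₁` coefficient group**.  The hypothesis is the
  printed situation `U_x := X ∖ {x}`, `x ∈ X(k)`, `X` proper (one puncture: in
  `π₁ = ⟨a_i, b_i, c ∣ ∏[a_i, b_i] · c = 1⟩^∧` the inertia generator `c` is a product of commutators,
  i.e. `Δ_{U_x}^{ab} = Δ_X^{ab}`), kept BY NAME as a hypothesis on the model.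

The SURJECTIVITY half (`H²(Δ_X, Ẑ)` is generated by the class of the cuspidally central extension —
Poincaré duality for the profinite completion of a surface group) is not in the tree and stays the
content of the named fact.  HONEST FRAMING: refereed pre-IUT material plus generic homological
algebra; nothing here bears on [IUTchIII] Cor. 3.12; typed ≠ proved.
-/

noncomputable section

open CategoryTheory Topology

universe u

namespace Literature.AnabelianGeometry.AbsoluteAnabelian.AbsTopIII

variable {E F : FundamentalExtension.{u}} (q : E ⟶ F)
variable (Λ : Type u) [AddCommGroup Λ] [TopologicalSpace Λ] [IsTopologicalAddGroup Λ]

/-- **Injectivity criterion for the differential of Prop. 1.4 (ii)**: `d_s` is injective iff every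
continuous homomorphism `Δ^{c-cn}_{U_x} → Λ` vanishes on `Ker(Δ^{c-cn}_{U_x} ↠ Δ_X)` (exactness of the
five-term sequence at `Hom(Ker, Λ)`). [cite: MochizukiAbsTopIII2015, Prop 1.4 (ii) p.31] -/
theorem ccnTransgression_injective_iff (s : CcnSection q) :
    Function.Injective (ccnTransgression q Λ s) ↔
      ∀ ψ : Additive (DeltaCcn q) →ₜ+ Λ,
        ∀ a : ContinuousCohomology.extKer (deltaCcnProjₜ q), ψ (Additive.ofMul (a : DeltaCcn q)) = 0 :=
  ContinuousCohomology.transgression_injective_iff (deltaCcnProjₜ q) s.toFun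
    (fun d => s.proj_apply d) (deltaCcn_central q)

/-- `Δ_{U_x} → Δ^{c-cn}_{U_x}` (restriction of `Π_{U_x} ↠ Π_{U_x}/[N, Δ]⁻` to `Δ_{U_x}`), as a monoid
homomorphism into the subgroup `DeltaCcn q`; written inline (no definition) in the proofs below via
its graph. [cite: MochizukiAbsTopIII2015, Prop 1.4 (ii) p.31] -/
theorem exists_geom_mk_eq (a : ContinuousCohomology.extKer (deltaCcnProjₜ q)) :
    ∃ n : E.arith, n ∈ cuspidalKernel q ∧
      (QuotientGroup.mk n : CuspidallyCentralQuotient q) = ((a : DeltaCcn q) : CuspidallyCentralQuotient q) := by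
  have ha : (a : DeltaCcn q) ∈ (geomCyclotome q).subgroupOf (DeltaCcn q) := by
    rw [← extKer_deltaCcnProjₜ]
    exact a.2
  rw [Subgroup.mem_subgroupOf] at ha
  obtain ⟨n, hn, hna⟩ := Subgroup.mem_map.mp ha
  exact ⟨n, hn, hna⟩

/-- **`d_s` is injective when `N ≤ [Δ_{U_x}, Δ_{U_x}]⁻`** (`T₁` coefficients): a continuous
homomorphism `Δ^{c-cn}_{U_x} → Λ` pulled back to `Δ_{U_x}` kills commutators, hence the closure of the
commutator subgroup, hence `N`, i.e. it kills the image `Ker(Δ^{c-cn}_{U_x} ↠ Δ_X)` of `N`.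
[cite: MochizukiAbsTopIII2015, Prop 1.4 (ii) p.31] -/
theorem ccnTransgression_injective_of_cuspidalKernel_le [T1Space Λ] (s : CcnSection q)
    (hN : cuspidalKernel q ≤ (⁅E.geom, E.geom⁆).topologicalClosure) :
    Function.Injective (ccnTransgression q Λ s) := by
  rw [ccnTransgression_injective_iff]
  intro ψ a
  obtain ⟨n, hn, hna⟩ := exists_geom_mk_eq q a
  have hnΔ : n ∈ E.geom := cuspidalKernel_le_geom q hn
  -- `θ : Δ_{U_x} → Δ^{c-cn}_{U_x}` and the pulled-back character `ψ' = ψ ∘ θ`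
  let θ : E.geom → DeltaCcn q := fun δ =>
    ⟨QuotientGroup.mk (δ : E.arith), Subgroup.mem_map.mpr ⟨δ, δ.2, rfl⟩⟩
  have hθc : Continuous θ :=
    Continuous.subtype_mk (QuotientGroup.continuous_mk.comp continuous_subtype_val) _
  have hθmul : ∀ δ δ' : E.geom, θ (δ * δ') = θ δ * θ δ' := fun δ δ' =>
    Subtype.ext (by simp [θ])
  -- its kernel is a closed subgroup of `Δ_{U_x}` containing the commutator subgroup
  let K : Subgroup E.geom :=
    { carrier := {δ | ψ (Additive.ofMul (θ δ)) = 0}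
      one_mem' := by
        change ψ (Additive.ofMul (θ 1)) = 0
        have h1 : θ 1 = 1 := Subtype.ext (by simp [θ])
        rw [h1, ofMul_one, map_zero]
      mul_mem' := fun {x y} hx hy => by
        change ψ (Additive.ofMul (θ (x * y))) = 0
        rw [hθmul, ofMul_mul, map_add, hx, hy, add_zero]
      inv_mem' := fun {x} hx => by
        change ψ (Additive.ofMul (θ x⁻¹)) = 0
        have hi : θ x⁻¹ = (θ x)⁻¹ := by
          apply eq_inv_of_mul_eq_one_left
          rw [← hθmul, inv_mul_cancel]
          exact Subtype.ext (by simp [θ])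
        rw [hi, ofMul_inv, map_neg, hx, neg_zero] }
  have hKc : IsClosed (K : Set E.geom) :=
    isClosed_singleton.preimage (ψ.continuous.comp (continuous_ofMul.comp hθc))
  have hcomm : _root_.commutator E.geom ≤ K := by
    rw [commutator_def, Subgroup.commutator_le]
    intro x _ y _
    change ψ (Additive.ofMul (θ (x * y * x⁻¹ * y⁻¹))) = 0
    have hix : θ x⁻¹ = (θ x)⁻¹ := by
      apply eq_inv_of_mul_eq_one_left
      rw [← hθmul, inv_mul_cancel]
      exact Subtype.ext (by simp [θ])
    have hiy : θ y⁻¹ = (θ y)⁻¹ := by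
      apply eq_inv_of_mul_eq_one_left
      rw [← hθmul, inv_mul_cancel]
      exact Subtype.ext (by simp [θ])
    rw [hθmul, hθmul, hθmul, hix, hiy, ofMul_mul, ofMul_mul, ofMul_mul, ofMul_inv, ofMul_inv,
      map_add, map_add, map_add, map_neg, map_neg]
    abel
  have hK : (_root_.commutator E.geom).topologicalClosure ≤ K :=
    Subgroup.topologicalClosure_minimal _ hcomm hKc
  -- `n ∈ [Δ, Δ]⁻` (closure in `Π`) means `⟨n, _⟩ ∈ (commutator Δ)⁻` (closure in `Δ`)
  have hmem : (⟨n, hnΔ⟩ : E.geom) ∈ (_root_.commutator E.geom).topologicalClosure := by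
    have h1 : n ∈ closure ((⁅E.geom, E.geom⁆ : Subgroup E.arith) : Set E.arith) := hN hn
    rw [← Subgroup.map_subtype_commutator, Subgroup.coe_map] at h1
    change (⟨n, hnΔ⟩ : E.geom) ∈ closure ((_root_.commutator E.geom : Subgroup E.geom) : Set E.geom)
    rw [Topology.IsEmbedding.subtypeVal.closure_eq_preimage_closure_image]
    exact h1
  have hkill : ψ (Additive.ofMul (θ ⟨n, hnΔ⟩)) = 0 := hK hmem
  have hθn : θ ⟨n, hnΔ⟩ = (a : DeltaCcn q) := Subtype.ext hna
  rw [hθn] at hkill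
  exact hkill

namespace CurveModel

variable (M : CurveModel.{u})

/-- **Prop. 1.4 (ii), injectivity half, relative to `M`, PROVED at the printed instance class.**  For
every cyclotome presentation `(U_x ⊆ X, x)` of the model whose inertia group lies in the closed
commutator subgroup of `Δ_{U_x}` — "`U_x := X ∖ {x}`", one puncture, so that the inertia generator is a
product of commutators in `π₁` and `Δ_{U_x}^{ab} = Δ_X^{ab}` — the differential
`Hom_cont(Ker(Δ^{c-cn}_{U_x} ↠ Δ_X), Λ) → H²(Δ_X, Λ)` of Prop. 1.4 (ii) is INJECTIVE, for every
continuous section and every `T₁` coefficient group `Λ` (in particular `Λ = Ẑ = ZHatCoeff`).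
(`N = [I_x]⁻` by `IsCyclotomePresentation.kernel_eq`, and `[I_x]⁻ ≤ [Δ, Δ]⁻` since the latter is a
closed normal subgroup of `Π_{U_x}`.)  The surjectivity half is not proved here.
[cite: MochizukiAbsTopIII2015, Prop 1.4 (ii) p.31] -/
theorem ccnTransgression_injective_of_inertia_le_commutator {Ux X : M.Curve}
    (h : M.IsCofiniteOpen Ux X) (x : (M.cusps Ux).Cusp) (hp : M.IsCyclotomePresentation h x)
    (hI : (M.cusps Ux).Icusp x ≤ (⁅(M.ext Ux).geom, (M.ext Ux).geom⁆).topologicalClosure)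
    (Λ : Type u) [AddCommGroup Λ] [TopologicalSpace Λ] [IsTopologicalAddGroup Λ] [T1Space Λ]
    (s : CcnSection (M.res h)) :
    Function.Injective (ccnTransgression (M.res h) Λ s) := by
  refine ccnTransgression_injective_of_cuspidalKernel_le (M.res h) Λ s ?_
  rw [hp.kernel_eq]
  -- `[Δ, Δ]⁻` is a closed normal subgroup of `Π_{U_x}` containing `I_x`
  haveI : (⁅(M.ext Ux).geom, (M.ext Ux).geom⁆).Normal := Subgroup.commutator_normal _ _
  haveI : (⁅(M.ext Ux).geom, (M.ext Ux).geom⁆).topologicalClosure.Normal :=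
    Subgroup.is_normal_topologicalClosure _
  refine Subgroup.topologicalClosure_minimal _ ?_ (Subgroup.isClosed_topologicalClosure _)
  exact Subgroup.normalClosure_le_normal hI

/-- The same for `Λ = Ẑ` (`ZHatCoeff`), the coefficients of `Prop_1_4_ii_transgression`: under the
commutator hypothesis the named fact's differential is injective; only its surjectivity remains an
input. [cite: MochizukiAbsTopIII2015, Prop 1.4 (ii) p.31] -/
theorem ccnTransgression_zhat_injective_of_inertia_le_commutator {Ux X : M.Curve}
    (h : M.IsCofiniteOpen Ux X) (x : (M.cusps Ux).Cusp) (hp : M.IsCyclotomePresentation h x)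
    (hI : (M.cusps Ux).Icusp x ≤ (⁅(M.ext Ux).geom, (M.ext Ux).geom⁆).topologicalClosure)
    (s : CcnSection (M.res h)) :
    Function.Injective (ccnTransgression (M.res h) ZHatCoeff.{u} s) :=
  M.ccnTransgression_injective_of_inertia_le_commutator h x hp hI ZHatCoeff.{u} s

end CurveModel

end Literature.AnabelianGeometry.AbsoluteAnabelian.AbsTopIII
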